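import Literature.Probability.LatticeModels.BackboneKernel
import Literature.Probability.LatticeModels.ModifiedSimonInequality
import Summits.CriticalPhenomena.Ising3DConformalLimit.Theorems.FKParityRobustnessDepletionBoundHTE
import HarnessLib

/-!
# Stub `stub_supermodular` — GKS supermodularity of sourceless current sums in the support
# (crux `ExistsContinuousLimit`, stmt-CriticalPhenomena-4582, line `free-box-deficit`, lead c5)

Registered stub 1 of the checked skeleton of line `free-box-deficit` of the crux
`Summit.CriticalPhenomena.Ising3DConformalLimit.Theses.ReflectionTwin.ExistsContinuousLimit`.

**Statement.** For a locally finite graph `G`, a finite volume `Λ`, `β ≥ 0` and edge sets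
`E₁, E₂ ⊆ E ⊆ ℰ_Λ`, the sourceless current sums `Z_{E'}(∅) = currentZ G Λ β E' ∅` satisfy

  `Z_{E₁}(∅) · Z_{E₂}(∅) ≤ Z_{E₁ ∩ E₂}(∅) · Z_E(∅)`.

**Proof.** By the parity-class evaluation (`gcurrentZ_eq_ofReal_ghteSum`, constant coupling `θ ≡ β`)
`Z_{E'}(∅) = cosh(β)^{|E'|} g_{E'}(∅)` with the high-temperature sum
`g_{E'}(∅) = ∑_{F ⊆ E', ∂F = ∅} tanh(β)^{|F|}` (`ghteSum`). The factor `cosh(β)^{|E₁| + |E₂|}` is at most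
`cosh(β)^{|E₁ ∩ E₂| + |E|}` (`cosh β ≥ 1`, `|E₁| + |E₂| = |E₁ ∪ E₂| + |E₁ ∩ E₂| ≤ |E| + |E₁ ∩ E₂|`), and
`g_{E₁}(∅) g_{E₂}(∅) ≤ g_{E₁ ∩ E₂}(∅) g_E(∅)` is the tree's edge-set supermodularity of `E' ↦ log g_{E'}(∅)`
(`ghteSum_empty_supermodular`, Aizenman–Fernández 1986, Claim (4.15); Aizenman 1982, Lemma 9.3 — Griffiths II
one edge at a time, PROVED in `BackboneKernel`) for `X = E`, `A = E ∖ E₁`, `B = E ∖ E₂`, transported from the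
ghost graph on `Option V` (where that theorem lives; with the constant coupling `θ ≡ β` no ghost edge is used)
back to `G` along the edge lift `liftEdge` (`ghteSum_map_liftEdge_empty`; adapted from the `Fintype` version in
`Theorems/FKParityRobustnessDepletionBoundHTE`, whose degree computations under the lift are reused).
-/

noncomputable section

namespace Summit.CriticalPhenomena.Ising3DConformalLimit.ReflectionTwinExistsContinuousLimit.FreeBox

open Finset Filter
open scoped BigOperators symmDiff ENNReal Topology
open Literature.Probability.LatticeModels
open Summit.CriticalPhenomena.Ising3DConformalLimit.Theorems.DepletionBound
  (card_filter_map_liftEdge_some card_filter_map_liftEdge_none)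
open Classical

section Transport

variable {V : Type*} [DecidableEq V]

/-! ### Current sums at constant coupling as high-temperature sums -/

/-- The current sums at inverse temperature `β` are the edge-dependent current sums at the constant coupling
`θ ≡ β` (same weights `∏_e β^{n_e}/n_e!`). [folklore] -/
theorem currentZ_eq_gcurrentZ_const (G : SimpleGraph V) [G.LocallyFinite] (Λ : Finset V) (β : ℝ)
    (E' : Finset (Sym2 V)) (A : Finset V) :
    currentZ G Λ β E' A = gcurrentZ G Λ (fun _ : Sym2 V => β) E' A := rfl

/-- **Parity-class evaluation at constant coupling**: for `E' ⊆ ℰ_Λ` and `β ≥ 0`,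
`Z_{E'}(A) = cosh(β)^{|E'|} · g_{E'}(A)` with `g_{E'}(A) = ∑_{F ⊆ E', ∂F = A} tanh(β)^{|F|}`
(Duminil-Copin 2016, Remark 3.4). [folklore] -/
theorem currentZ_eq_ofReal_ghteSum_const (G : SimpleGraph V) [G.LocallyFinite] (Λ : Finset V) {β : ℝ}
    (hβ : 0 ≤ β) {E' : Finset (Sym2 V)} (hE' : E' ⊆ edgesIn G Λ) (A : Finset V) :
    currentZ G Λ β E' A = ENNReal.ofReal (Real.cosh β ^ #E' * ghteSum Λ (fun _ : Sym2 V => β) E' A) := by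
  rw [currentZ_eq_gcurrentZ_const, gcurrentZ_eq_ofReal_ghteSum G Λ (fun _ => hβ) hE']
  simp only [prod_const]

/-! ### Degrees under the edge lift `V → Option V`

The degree computations `card_filter_map_liftEdge_some/none` are the tree's
(`Theorems/FKParityRobustnessDepletionBoundHTE`); the parity transfer below replaces its `Fintype` version
(`insertNone univ`) by the finite volume `insertNone Λ`. -/

/-- "No odd vertex in `Λ`" and "the lift has no odd vertex in `Λ ∪ {g}`" are the same condition (the ghost
has degree `0` in a lifted edge set). [folklore] -/
theorem oddVerts_map_liftEdge_eq_empty_iff (Λ : Finset V) (F : Finset (Sym2 V)) :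
    oddVerts (Finset.insertNone Λ) (F.map liftEdge) = ∅ ↔ oddVerts Λ F = ∅ := by
  simp only [oddVerts, Finset.filter_eq_empty_iff]
  constructor
  · intro h v hv hodd
    refine h (x := some v) (Finset.some_mem_insertNone.2 hv) ?_
    rwa [card_filter_map_liftEdge_some]
  · intro h v hv hodd
    rcases v with _ | u
    · rw [card_filter_map_liftEdge_none] at hodd
      exact Nat.not_odd_zero hodd
    · rw [card_filter_map_liftEdge_some] at hodd
      exact h (Finset.some_mem_insertNone.1 hv) hodd

/-! ### Transport of `g_{E'}(∅)` along the lift -/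

/-- **Transport.** The ghost-graph high-temperature sum of a lifted edge set, with constant coupling `β`
and no sources, is the high-temperature sum `g_{E'}(∅)` of the original edge set. [folklore] -/
theorem ghteSum_map_liftEdge_empty (Λ : Finset V) (β : ℝ) (E' : Finset (Sym2 V)) :
    ghteSum (Finset.insertNone Λ) (fun _ : Sym2 (Option V) => β) (E'.map liftEdge) ∅ =
      ghteSum Λ (fun _ : Sym2 V => β) E' ∅ := by
  unfold ghteSum
  simp only [Finset.prod_const]
  symm
  refine Finset.sum_bij (fun F _ => F.map liftEdge) ?_ ?_ ?_ ?_
  · intro F hF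
    rw [Finset.mem_filter, Finset.mem_powerset] at hF ⊢
    exact ⟨Finset.map_subset_map.2 hF.1, (oddVerts_map_liftEdge_eq_empty_iff Λ F).2 hF.2⟩
  · intro F₁ _ F₂ _ h
    exact Finset.map_injective liftEdge h
  · intro F' hF'
    rw [Finset.mem_filter, Finset.mem_powerset] at hF'
    obtain ⟨F, hFE, rfl⟩ := Finset.subset_map_iff.1 hF'.1
    refine ⟨F, ?_, rfl⟩
    rw [Finset.mem_filter, Finset.mem_powerset]
    exact ⟨hFE, (oddVerts_map_liftEdge_eq_empty_iff Λ F).1 hF'.2⟩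
  · intro F _
    rw [Finset.card_map]

/-! ### Edge-set supermodularity of `E' ↦ log g_{E'}(∅)` on `G` -/

/-- **Edge-set supermodularity of the sourceless high-temperature sum** (Aizenman–Fernández 1986,
Claim (4.15) / Aizenman 1982, Lemma 9.3, in the tree as `ghteSum_empty_supermodular` on the ghost graph):
for `β ≥ 0` and `E₁, E₂ ⊆ E ⊆ ℰ_Λ`, `g_{E₁}(∅) g_{E₂}(∅) ≤ g_{E₁ ∩ E₂}(∅) g_E(∅)`. [folklore] -/
theorem ghteSum_const_empty_supermodular (G : SimpleGraph V) [G.LocallyFinite] (Λ : Finset V) {β : ℝ}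
    (hβ : 0 ≤ β) {E₁ E₂ E : Finset (Sym2 V)} (h₁ : E₁ ⊆ E) (h₂ : E₂ ⊆ E) (hE : E ⊆ edgesIn G Λ) :
    ghteSum Λ (fun _ : Sym2 V => β) E₁ ∅ * ghteSum Λ (fun _ : Sym2 V => β) E₂ ∅ ≤
      ghteSum Λ (fun _ : Sym2 V => β) (E₁ ∩ E₂) ∅ * ghteSum Λ (fun _ : Sym2 V => β) E ∅ := by
  set X : Finset (Sym2 (Option V)) := E.map liftEdge with hXdef
  set X₁ : Finset (Sym2 (Option V)) := E₁.map liftEdge with hX₁def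
  set X₂ : Finset (Sym2 (Option V)) := E₂.map liftEdge with hX₂def
  have hX : X ⊆ edgesIn (ghostGraph G Λ) (Finset.insertNone Λ) :=
    (Finset.map_subset_map.2 hE).trans (map_liftEdge_subset_edgesIn (G := G) (Λ := Λ) (Finset.Subset.refl Λ))
  have hX₁ : X₁ ⊆ X := Finset.map_subset_map.2 h₁
  have hX₂ : X₂ ⊆ X := Finset.map_subset_map.2 h₂
  have key := ghteSum_empty_supermodular (θ := fun _ : Sym2 (Option V) => β) (fun _ => hβ) hX
    (X \ X₁) (X \ X₂)
  rw [Finset.sdiff_sdiff_eq_self hX₁, Finset.sdiff_sdiff_eq_self hX₂,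
    show X \ (X \ X₁ ∪ X \ X₂) = X₁ ∩ X₂ by
      rw [← Finset.sdiff_inter_distrib_right, Finset.sdiff_sdiff_eq_self
        (Finset.inter_subset_left.trans hX₁)],
    hX₁def, hX₂def, ← Finset.map_inter, hXdef,
    ghteSum_map_liftEdge_empty, ghteSum_map_liftEdge_empty, ghteSum_map_liftEdge_empty,
    ghteSum_map_liftEdge_empty] at key
  exact key

end Transport

/-! ### The registered stub -/

/-- **Stub 1 — GKS supermodularity of sourceless current sums in the support.** For `β ≥ 0` and edge sets
`E₁, E₂ ⊆ E ⊆ ℰ_Λ`: `Z_{E₁}(∅) Z_{E₂}(∅) ≤ Z_{E₁∩E₂}(∅) Z_E(∅)` (`2^{|Λ|} Z_{E'}(∅) = ∑_σ ∏_{e∈E'} e^{βσ_e}`;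
log-supermodularity and monotonicity of the Ising partition function in the couplings, GKS I–II; here via
`Z_{E'}(∅) = cosh(β)^{|E'|} g_{E'}(∅)` and the edge-set supermodularity of `g` transported from
`BackboneKernel.ghteSum_empty_supermodular`). [folklore] -/
theorem stub_supermodular {V : Type*} [DecidableEq V] (G : SimpleGraph V) [G.LocallyFinite] (Λ : Finset V)
    {β : ℝ} (hβ : 0 ≤ β) (E₁ E₂ E : Finset (Sym2 V)) (h₁ : E₁ ⊆ E) (h₂ : E₂ ⊆ E) (hE : E ⊆ edgesIn G Λ) :
    currentZ G Λ β E₁ ∅ * currentZ G Λ β E₂ ∅ ≤ currentZ G Λ β (E₁ ∩ E₂) ∅ * currentZ G Λ β E ∅ := by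
  have hc0 : 0 ≤ Real.cosh β := (Real.cosh_pos β).le
  have hc1 : 1 ≤ Real.cosh β := Real.one_le_cosh β
  have hg0 : ∀ E' : Finset (Sym2 V), 0 ≤ ghteSum Λ (fun _ : Sym2 V => β) E' ∅ := fun E' =>
    ghteSum_nonneg (fun _ => hβ) E' ∅
  have h12 : E₁ ∩ E₂ ⊆ edgesIn G Λ := Finset.inter_subset_left.trans (h₁.trans hE)
  rw [currentZ_eq_ofReal_ghteSum_const G Λ hβ (h₁.trans hE), currentZ_eq_ofReal_ghteSum_const G Λ hβ (h₂.trans hE),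
    currentZ_eq_ofReal_ghteSum_const G Λ hβ h12, currentZ_eq_ofReal_ghteSum_const G Λ hβ hE,
    ← ENNReal.ofReal_mul (mul_nonneg (pow_nonneg hc0 _) (hg0 _)),
    ← ENNReal.ofReal_mul (mul_nonneg (pow_nonneg hc0 _) (hg0 _))]
  refine ENNReal.ofReal_le_ofReal ?_
  have hsm := ghteSum_const_empty_supermodular G Λ hβ h₁ h₂ hE
  have hcard : #E₁ + #E₂ ≤ #(E₁ ∩ E₂) + #E := by
    have hui := Finset.card_union_add_card_inter E₁ E₂
    have hu := Finset.card_le_card (Finset.union_subset h₁ h₂)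
    omega
  have hpow : Real.cosh β ^ #E₁ * Real.cosh β ^ #E₂ ≤ Real.cosh β ^ #(E₁ ∩ E₂) * Real.cosh β ^ #E := by
    rw [← pow_add, ← pow_add]
    exact pow_le_pow_right₀ hc1 hcard
  calc Real.cosh β ^ #E₁ * ghteSum Λ (fun _ : Sym2 V => β) E₁ ∅ *
        (Real.cosh β ^ #E₂ * ghteSum Λ (fun _ : Sym2 V => β) E₂ ∅)
      = (Real.cosh β ^ #E₁ * Real.cosh β ^ #E₂) *
          (ghteSum Λ (fun _ : Sym2 V => β) E₁ ∅ * ghteSum Λ (fun _ : Sym2 V => β) E₂ ∅) := by ring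
    _ ≤ (Real.cosh β ^ #(E₁ ∩ E₂) * Real.cosh β ^ #E) *
          (ghteSum Λ (fun _ : Sym2 V => β) (E₁ ∩ E₂) ∅ * ghteSum Λ (fun _ : Sym2 V => β) E ∅) :=
        mul_le_mul hpow hsm (mul_nonneg (hg0 _) (hg0 _)) (mul_nonneg (pow_nonneg hc0 _) (pow_nonneg hc0 _))
    _ = Real.cosh β ^ #(E₁ ∩ E₂) * ghteSum Λ (fun _ : Sym2 V => β) (E₁ ∩ E₂) ∅ *
          (Real.cosh β ^ #E * ghteSum Λ (fun _ : Sym2 V => β) E ∅) := by ring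

end Summit.CriticalPhenomena.Ising3DConformalLimit.ReflectionTwinExistsContinuousLimit.FreeBox

end
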